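import Summits.SmoothPoincare4.SmoothPoincare4.Theorems.CongruenceShadowsAgkCor6SufficiencyStubCoresLevel

/-!
# Stub `stub_cores` of line `lp-by-sphere-system-surgery` for crux `AgkCor6Sufficiency`
(item stmt-SmoothPoincare4-10894, routes CongruenceShadows / GroupTrisection; lead reshape r5, D)

**Cores from the transport.**  The last step of `HandlebodyExtension → SpineRigidityWithCores`
(Abrams–Gay–Kirby, *Group trisections and smooth 4-manifolds* (2018), proof of Thm. 5): two
closed oriented `4`-manifolds `X`, `X'` carry normalised ambient Morse presentations
`hP : SpinePresentation S u v ρ U O T₀ G k`, `hP'` of the sectors of their trisections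
(`…SpineDefs.lean`), and a transport `SpineTransport S S' G G'` — mutually inverse maps `Γ`, `Γ'`
of open spine neighbourhoods `Ug ⊇ ⋃ ∂S m`, `Ug'`, smooth, sector-preserving and intertwining the
presentations (`G' m ∘ Γ = G m` on `S m ∩ Ug`).  We produce:

* ONE scale `a > 0` for both sides, so small that the level `lev = 1 - a/4` lies above all
  interior critical values of the `G m`, `G' m` and that `{G m ≥ lev} ∩ S m ⊆ Ug`,
  `{G' m ≥ lev} ∩ S' m ⊆ Ug'` (`eventually_criticalValues_lt`, `eventually_superlevel_subset`,
  `…StubCoresLevel.lean`);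
* the level functions `f|S m = coreProfile ((1 - G m) · 2/a)`, `f'` likewise (`exists_levelFun`),
  smooth with regular level `1/2` (`isRegularLevel_levelFun`);
* the cores `V m = {G m ≤ lev} ∩ S m` — regular sublevel sets of `G m` restricted to the open
  sector `interior (S m)`, compact connected orientable `1`-handlebodies (Milnor 1963, Thm. 3.1
  with the Morse data; Reeb) — with `{f ≥ 1/2} ≅ V 0 ⊕ (V 1 ⊕ V 2)` (`superlevel_cores` below,
  from the Morse toolkit `…StubCoresMorse.lean`), on both sides;
* the diffeomorphism `{f ≤ 1/2} ≅ {f' ≤ 1/2}` induced by `Γ`: `{f ≤ 1/2} = ⋃ {G m ≥ lev} ∩ S m ⊆ Ug`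
  is carried into `{f' ≤ 1/2}` since `f' ∘ Γ = f` there, and back by `Γ'`
  (`nonempty_diffeomorph_sublevel_of_transport`).

This file declares the line's statement `CoresStmt` (verbatim from the checked skeleton) and
proves the registered stub `stub_cores`.  (The skeleton's docstring names the straightened-sector
route `CornerSliceAtlas.isMorseAdapted_comp_val` + `core_package` for the cores; here the same
subsets `{G m ≤ lev} ∩ S m ⊆ interior (S m)` are certified more directly as regular sublevel sets
of `G m` on the open sectors, `RegularSublevel.morseData` — `CoresStmt` only asserts the existence
of the handlebody structures and of the diffeomorphisms.)
References: Abrams–Gay–Kirby, Geom. Topol. 22 (2018), proof of Thm. 5 [AbramsGayKirby2018];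
Gay–Kirby, Geom. Topol. 20 (2016), Def. 1 [GayKirby2016]; Milnor, *Morse theory* (1963), Thm. 3.1
[Milnor1963].
-/

noncomputable section

-- the prescribed namespace `Summit.<P>.<Sub>.…` duplicates `SmoothPoincare4` (P = Sub)
set_option linter.dupNamespace false

namespace Summit.SmoothPoincare4.SmoothPoincare4.Cruxes.AgkCor6Sufficiency.LpBySphereSystemSurgery

open Set Function Filter
open scoped _root_.Manifold _root_.ContDiff _root_.Topology
open Literature.Topology.FourManifolds

/-! ## The statement (verbatim from the skeleton) -/

/-- **D — cores from the transport** (re-run of the landed `stub_sectorCores` on the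
normalised ambient presentations: `f|S m = coreProfile ((1 - G m) · 2/a)` with one `a` for both
sides, `{f ≤ 1/2} = Γ⁻¹ {f' ≤ 1/2}` and `f = f' ∘ Γ` near it, cores `{G m ≤ 1 - a/4} ∩ S m` are
compact connected orientable `1`-handlebodies by `CornerSliceAtlas.isMorseAdapted_comp_val` and
`core_package`). -/
def CoresStmt : Prop :=
  ∀ (X : Type) [TopologicalSpace X] [T2Space X] [SecondCountableTopology X]
    [ChartedSpace (EuclideanSpace ℝ (Fin 4)) X] [IsManifold (𝓡 4) ∞ X] [CompactSpace X]
    [ConnectedSpace X] (_ : SmoothOrientation (𝓡 4) X)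
    (X' : Type) [TopologicalSpace X'] [T2Space X'] [SecondCountableTopology X']
    [ChartedSpace (EuclideanSpace ℝ (Fin 4)) X'] [IsManifold (𝓡 4) ∞ X'] [CompactSpace X']
    [ConnectedSpace X'] (_ : SmoothOrientation (𝓡 4) X')
    (k : ℕ) (S : Fin 3 → Set X) (S' : Fin 3 → Set X')
    (u v : X → ℝ) (ρ : X → X) (U O T₀ : Set X) (G : Fin 3 → X → ℝ)
    (u' v' : X' → ℝ) (ρ' : X' → X') (U' O' T₀' : Set X') (G' : Fin 3 → X' → ℝ),
    SpinePresentation S u v ρ U O T₀ G k → SpinePresentation S' u' v' ρ' U' O' T₀' G' k →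
    SpineTransport S S' G G' →
    ∃ (f : X → ℝ) (f' : X' → ℝ) (hf : IsRegularLevel (𝓡 4) f (1 / 2))
      (hf' : IsRegularLevel (𝓡 4) f' (1 / 2))
      (V : Fin 3 → Type) (_ : ∀ i, TopologicalSpace (V i)) (_ : ∀ i, T2Space (V i))
      (_ : ∀ i, SecondCountableTopology (V i)) (_ : ∀ i, CompactSpace (V i))
      (_ : ∀ i, ConnectedSpace (V i)) (_ : ∀ i, ChartedSpace (EuclideanHalfSpace 4) (V i))
      (_ : ∀ i, IsManifold (𝓡∂ 4) ∞ (V i))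
      (_ : ∀ i, IsHandlebodyOfIndexLE 3 1 (V i)) (_ : ∀ i, IsOrientable (𝓡∂ 4) (V i))
      (V' : Fin 3 → Type) (_ : ∀ i, TopologicalSpace (V' i)) (_ : ∀ i, T2Space (V' i))
      (_ : ∀ i, SecondCountableTopology (V' i)) (_ : ∀ i, CompactSpace (V' i))
      (_ : ∀ i, ConnectedSpace (V' i)) (_ : ∀ i, ChartedSpace (EuclideanHalfSpace 4) (V' i))
      (_ : ∀ i, IsManifold (𝓡∂ 4) ∞ (V' i))
      (_ : ∀ i, IsHandlebodyOfIndexLE 3 1 (V' i)) (_ : ∀ i, IsOrientable (𝓡∂ 4) (V' i))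
      (_ : RegularSuperlevel hf ≃ₘ⟮𝓡∂ 4, 𝓡∂ 4⟯ (V 0 ⊕ (V 1 ⊕ V 2)))
      (_ : RegularSuperlevel hf' ≃ₘ⟮𝓡∂ 4, 𝓡∂ 4⟯ (V' 0 ⊕ (V' 1 ⊕ V' 2))),
      Nonempty (RegularSublevel hf ≃ₘ⟮𝓡∂ 4, 𝓡∂ 4⟯ RegularSublevel hf')

/-! ## One scale for both sides -/

section Scale

variable {X : Type} [TopologicalSpace X] [ChartedSpace (EuclideanSpace ℝ (Fin 4)) X]
  [IsManifold (𝓡 4) ∞ X]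
  {X' : Type} [TopologicalSpace X'] [ChartedSpace (EuclideanSpace ℝ (Fin 4)) X']
  [IsManifold (𝓡 4) ∞ X']
  {S : Fin 3 → Set X} {u v : X → ℝ} {ρ : X → X} {U O T₀ : Set X} {G : Fin 3 → X → ℝ} {k : ℕ}
  {S' : Fin 3 → Set X'} {u' v' : X' → ℝ} {ρ' : X' → X'} {U' O' T₀' : Set X'} {G' : Fin 3 → X' → ℝ}
  {k' : ℕ}

/-- **A common scale**: some `a > 0` puts the level `1 - a/4` above all interior critical values
of both presentations and the regions `{G m ≥ 1 - a/4} ∩ S m`, `{G' m ≥ 1 - a/4} ∩ S' m` inside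
the given open neighbourhoods `Ug`, `Ug'` of the non-interior points (all four conditions hold for
every small `a`). -/
theorem exists_common_scale (hP : SpinePresentation S u v ρ U O T₀ G k)
    (hP' : SpinePresentation S' u' v' ρ' U' O' T₀' G' k')
    {Ug : Set X} {Ug' : Set X'} (hUo : IsOpen Ug) (hUo' : IsOpen Ug')
    (hUg : ∀ m, ∀ x ∈ S m, x ∉ interior (S m) → x ∈ Ug)
    (hUg' : ∀ m, ∀ x ∈ S' m, x ∉ interior (S' m) → x ∈ Ug') :
    ∃ a : ℝ, 0 < a ∧
      (∀ m, ∀ x ∈ interior (S m), IsMCriticalPt (𝓡 4) (G m) x → G m x < 1 - a / 4) ∧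
      (∀ m, ∀ x ∈ interior (S' m), IsMCriticalPt (𝓡 4) (G' m) x → G' m x < 1 - a / 4) ∧
      (∀ m, ∀ x ∈ S m, 1 - a / 4 ≤ G m x → x ∈ Ug) ∧
      (∀ m, ∀ x ∈ S' m, 1 - a / 4 ≤ G' m x → x ∈ Ug') := by
  have h := ((eventually_criticalValues_lt hP).and (eventually_criticalValues_lt hP')).and
    ((eventually_superlevel_subset hP hUo hUg).and (eventually_superlevel_subset hP' hUo' hUg'))
  have hpos : ∀ᶠ a in 𝓝[>] (0 : ℝ), 0 < a := eventually_mem_nhdsWithin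
  obtain ⟨a, ha, ⟨h1, h2⟩, h3, h4⟩ := (hpos.and (nhdsWithin_le_nhds h)).exists
  exact ⟨a, ha, h1, h2, h3, h4⟩

end Scale

/-! ## The superlevel set and the three cores (one side) -/

section Cores

variable {X : Type} [TopologicalSpace X] [T2Space X] [SecondCountableTopology X]
  [ChartedSpace (EuclideanSpace ℝ (Fin 4)) X] [IsManifold (𝓡 4) ∞ X] [CompactSpace X]
  {S : Fin 3 → Set X} {u v : X → ℝ} {ρ : X → X} {U O T₀ : Set X} {G : Fin 3 → X → ℝ} {k : ℕ}

/-- **The cores of a normalised presentation** (the second half of the landed cored presentation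
`stub_sectorCores`, re-run on the ambient Morse functions).  For `a > 0` with all interior
critical values of the `G m` below `lev = 1 - a/4`, and a function `f` with regular level `1/2`
such that `{f ≥ 1/2} ∩ S m = {G m ≤ lev} ∩ S m`: the cores `V m` (regular sublevel sets of
`G m|_{interior (S m)}` at `lev`, `…StubCoresMorse.lean`) are compact connected orientable
`1`-handlebodies and `{f ≥ 1/2} ≅ V 0 ⊕ (V 1 ⊕ V 2)` — the superlevel set is partitioned by the
three open pieces over the open sectors (`nonempty_diffeomorph_of_partition`), each identified
with its core by the identity on points (smooth both ways by `HalfSliceAtlas.contMDiff_codRestrict`,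
smoothness into a regular domain being tested in the ambient manifold).
[cite: AbramsGayKirby2018, proof of Thm. 5] -/
theorem superlevel_cores (hP : SpinePresentation S u v ρ U O T₀ G k) (o : SmoothOrientation (𝓡 4) X)
    {a : ℝ} (ha : 0 < a)
    (hCV : ∀ m, ∀ x ∈ interior (S m), IsMCriticalPt (𝓡 4) (G m) x → G m x < 1 - a / 4)
    {f : X → ℝ} (hf : IsRegularLevel (𝓡 4) f (1 / 2))
    (hfS : ∀ m, ∀ x ∈ S m, (1 / 2 ≤ f x ↔ G m x ≤ 1 - a / 4)) :
    ∃ (V : Fin 3 → Type) (_ : ∀ i, TopologicalSpace (V i)) (_ : ∀ i, T2Space (V i))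
      (_ : ∀ i, SecondCountableTopology (V i)) (_ : ∀ i, CompactSpace (V i))
      (_ : ∀ i, ConnectedSpace (V i)) (_ : ∀ i, ChartedSpace (EuclideanHalfSpace 4) (V i))
      (_ : ∀ i, IsManifold (𝓡∂ 4) ∞ (V i))
      (_ : ∀ i, IsHandlebodyOfIndexLE 3 1 (V i)) (_ : ∀ i, IsOrientable (𝓡∂ 4) (V i)),
      Nonempty (RegularSuperlevel hf ≃ₘ⟮𝓡∂ 4, 𝓡∂ 4⟯ (V 0 ⊕ (V 1 ⊕ V 2))) := by
  set lev : ℝ := 1 - a / 4 with hlev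
  have hlev1 : lev < 1 := by simp only [hlev]; linarith
  have hreg : ∀ m, IsRegularLevel (𝓡 4) (openSectorFun S G m) lev := fun m =>
    isRegularLevel_openSectorFun hP (hCV m)
  set V : Fin 3 → Type := fun m => RegularSublevel (hreg m) with hV
  have hVc : ∀ m, CompactSpace (V m) := fun m => compactSpace_core hP hlev1 (hreg m)
  have hVconn : ∀ m, ConnectedSpace (V m) := fun m => connectedSpace_core hP hlev1 (hCV m) (hreg m)
  have hVhb : ∀ m, IsHandlebodyOfIndexLE 3 1 (V m) := fun m => isHandlebody_core hP (hreg m)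
  have hVo : ∀ m, IsOrientable (𝓡∂ 4) (V m) := fun m => isOrientable_core o (hreg m)
  /- ### the superlevel set and its three open pieces -/
  set Msup := RegularSuperlevel hf with hMsup
  have hsupf : ∀ p : Msup, 1 / 2 ≤ f (RegularSublevel.incl _ p) := fun p =>
    (level_le_iff_const_sub_nonpos (RegularSublevel.incl _ p)).2 p.2
  set P : Fin 3 → TopologicalSpace.Opens Msup := fun m =>
    ⟨{p | RegularSublevel.incl _ p ∈ interior (S m)},
      isOpen_interior.preimage (RegularSublevel.continuous_incl _)⟩ with hPdef
  have hPcov' : ∀ p : Msup, ∃ m, p ∈ P m := by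
    intro p
    obtain ⟨m, hxm⟩ := hP.exists_mem (RegularSublevel.incl _ p)
    exact ⟨m, hP.mem_interior_of_lt hxm (lt_of_le_of_lt ((hfS m _ hxm).1 (hsupf p)) hlev1)⟩
  have hPcov : ∀ p : Msup, p ∈ P 0 ∨ p ∈ P 1 ∨ p ∈ P 2 := by
    intro p
    obtain ⟨m, hm⟩ := hPcov' p
    fin_cases m
    · exact Or.inl hm
    · exact Or.inr (Or.inl hm)
    · exact Or.inr (Or.inr hm)
  have hPdisj : ∀ m m', m ≠ m' → Disjoint ((P m : Set Msup)) (P m') := by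
    intro m m' hmm'
    rw [Set.disjoint_left]
    intro p hpm hpm'
    exact hP.not_mem_interior_of_mem hmm' (interior_subset hpm') hpm
  obtain ⟨Φ₀⟩ : Nonempty (Msup ≃ₘ^∞⟮𝓡∂ 4, 𝓡∂ 4⟯ (P 0 ⊕ (P 1 ⊕ P 2))) :=
    nonempty_diffeomorph_of_partition (P 0) (P 1) (P 2) hPcov (hPdisj 0 1 (by decide))
      (hPdisj 0 2 (by decide)) (hPdisj 1 2 (by decide))
  /- ### the identifications `P m ≅ V m` (the identity on points) -/
  have hfwd_mem : ∀ m (p : P m),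
      (⟨RegularSublevel.incl _ p.1, p.2⟩ : openSector S m) ∈ openSectorFun S G m ⁻¹' Iic lev :=
    fun m p => (hfS m _ (interior_subset p.2)).1 (hsupf p.1)
  have hfwd_smooth : ∀ m, ContMDiff (𝓡∂ 4) (𝓡 4) ∞
      (fun p : P m => (⟨RegularSublevel.incl _ p.1, p.2⟩ : openSector S m)) := fun m =>
    (ContMDiff.subtypeVal_comp_iff (openSector S m) _).1
      ((RegularSublevel.contMDiff_incl _).comp contMDiff_subtype_val)
  have hbwd_le : ∀ m (z : V m), (fun y => 1 / 2 - f y) (RegularSublevel.incl _ z).1 ≤ 0 := by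
    intro m z
    rw [← level_le_iff_const_sub_nonpos]
    exact (hfS m _ (interior_subset (RegularSublevel.incl _ z).2)).2 z.2
  have hbwd_smooth : ∀ m, ContMDiff (𝓡∂ 4) (𝓡 4) ∞ (fun z : V m => (RegularSublevel.incl _ z).1) :=
    fun m => contMDiff_subtype_val.comp (RegularSublevel.contMDiff_incl _)
  have Q : ∀ m, (P m) ≃ₘ^∞⟮𝓡∂ 4, 𝓡∂ 4⟯ (V m) := fun m =>
    { toFun := Set.codRestrict _ _ (hfwd_mem m)
      invFun := fun z => ⟨Set.codRestrict (fun z : V m => (RegularSublevel.incl _ z).1) _ (hbwd_le m) z,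
        (RegularSublevel.incl _ z).2⟩
      left_inv := fun p => rfl
      right_inv := fun z => rfl
      contMDiff_toFun := (RegularSublevel.halfSliceAtlas (hreg m)).contMDiff_codRestrict
        (hfwd_mem m) (hfwd_smooth m)
      contMDiff_invFun := by
        intro z
        refine (ContMDiffAt.subtypeVal_comp_iff (P m) _ z).1 ?_
        exact ((RegularSublevel.halfSliceAtlas hf.const_sub).contMDiff_codRestrict (hbwd_le m)
          (hbwd_smooth m)) z }
  have Ψ : Msup ≃ₘ⟮𝓡∂ 4, 𝓡∂ 4⟯ (V 0 ⊕ (V 1 ⊕ V 2)) :=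
    Φ₀.trans ((Q 0).sumCongr ((Q 1).sumCongr (Q 2)))
  exact ⟨V, fun m => inferInstance, fun m => inferInstance, fun m => inferInstance, hVc, hVconn,
    fun m => inferInstance, fun m => inferInstance, hVhb, hVo, ⟨Ψ⟩⟩

end Cores

/-! ## The registered stub -/

/-- **Stub `stub_cores` — cores from the transport** (D of the lead's reshape r5 of the AGK
Thm. 5 assembly): one scale for both sides, the level functions `coreProfile ((1 - G m) · 2/a)`
with regular level `1/2`, the cores as regular sublevel sets of the `G m` on the open sectors
(compact connected orientable `1`-handlebodies, `{f ≥ 1/2} ≅ V 0 ⊕ (V 1 ⊕ V 2)`), and the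
identification `{f ≤ 1/2} ≅ {f' ≤ 1/2}` by the transport `Γ`.
[cite: AbramsGayKirby2018, proof of Thm. 5] -/
theorem stub_cores : CoresStmt := by
  intro X _ _ _ _ _ _ _ o X' _ _ _ _ _ _ _ o' k S S' u v ρ U O T₀ G u' v' ρ' U' O' T₀' G' hP hP' hΓ
  obtain ⟨Ug, Ug', Γ, Γ', hUo, hUo', hUg, hUg', hΓs, hΓ's, -, hΓ'm, hinv, hinv', hΓS, hΓ'S, hΓG⟩ :=
    hΓ
  /- ### the scale and the level functions -/
  obtain ⟨a, ha, hCV, hCV', hW, hW'⟩ := exists_common_scale hP hP' hUo hUo' hUg hUg'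
  obtain ⟨f, hfs, hfS⟩ := exists_levelFun hP ha
  obtain ⟨f', hfs', hfS'⟩ := exists_levelFun hP' ha
  have hf : IsRegularLevel (𝓡 4) f (1 / 2) := isRegularLevel_levelFun hP ha hCV hfs hfS
  have hf' : IsRegularLevel (𝓡 4) f' (1 / 2) := isRegularLevel_levelFun hP' ha hCV' hfs' hfS'
  /- ### the cores of both sides -/
  obtain ⟨V, i₁, i₂, i₃, i₄, i₅, i₆, i₇, hVhb, hVo, ⟨Ψ⟩⟩ :=
    superlevel_cores hP o ha hCV hf fun m x hx => half_le_levelFun_iff ha hfS hx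
  obtain ⟨V', i₁', i₂', i₃', i₄', i₅', i₆', i₇', hVhb', hVo', ⟨Ψ'⟩⟩ :=
    superlevel_cores hP' o' ha hCV' hf' fun m x hx => half_le_levelFun_iff ha hfS' hx
  /- ### the sublevel sets correspond under the transport -/
  have hsub : ∀ x, f x ≤ 1 / 2 → x ∈ Ug := fun x hx => by
    obtain ⟨m, hxm⟩ := hP.exists_mem x
    exact hW m x hxm ((levelFun_le_half_iff ha hfS hxm).1 hx)
  have hsub' : ∀ y, f' y ≤ 1 / 2 → y ∈ Ug' := fun y hy => by
    obtain ⟨m, hym⟩ := hP'.exists_mem y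
    exact hW' m y hym ((levelFun_le_half_iff ha hfS' hym).1 hy)
  have hlev : ∀ x, f x ≤ 1 / 2 → f' (Γ x) ≤ 1 / 2 := fun x hx => by
    obtain ⟨m, hxm⟩ := hP.exists_mem x
    have hxU : x ∈ Ug := hsub x hx
    rw [levelFun_le_half_iff ha hfS' (hΓS m x hxU hxm), hΓG m x hxU hxm]
    exact (levelFun_le_half_iff ha hfS hxm).1 hx
  have hlev' : ∀ y, f' y ≤ 1 / 2 → f (Γ' y) ≤ 1 / 2 := fun y hy => by
    obtain ⟨m, hym⟩ := hP'.exists_mem y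
    have hyU : y ∈ Ug' := hsub' y hy
    have h1 : Γ' y ∈ S m := hΓ'S m y hyU hym
    have h3 : G' m (Γ (Γ' y)) = G m (Γ' y) := hΓG m (Γ' y) (hΓ'm hyU) h1
    rw [hinv' y hyU] at h3
    rw [levelFun_le_half_iff ha hfS h1, ← h3]
    exact (levelFun_le_half_iff ha hfS' hym).1 hy
  obtain ⟨Θ⟩ := nonempty_diffeomorph_sublevel_of_transport hf hf' hΓs hΓ's hsub hsub' hlev hlev'
    (fun x hx => hinv x (hsub x hx)) (fun y hy => hinv' y (hsub' y hy))
  exact ⟨f, f', hf, hf', V, i₁, i₂, i₃, i₄, i₅, i₆, i₇, hVhb, hVo, V', i₁', i₂', i₃', i₄', i₅', i₆',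
    i₇', hVhb', hVo', Ψ, Ψ', ⟨Θ⟩⟩

end Summit.SmoothPoincare4.SmoothPoincare4.Cruxes.AgkCor6Sufficiency.LpBySphereSystemSurgery

end
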